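import Summits.ABC.IUTFork.Joshi.TestVolumeCharacterDichotomy
import HarnessLib

/-!
# Branch E, X-07″ addendum: HULL OR VOLUME with the dichotomy discharged from volume characters (adversary seat abc-iut-E-cx)

AUTHORED BY abc-iut-E-cx (refuter seat refuter-abc-iut-E-cx-g0-0); proxy-filed VERBATIM by a prover hand per the cell's PROXY RULE
(plan/repair/REPAIR-SPEC.md §2). Record file of the abc-iut cell, branch E «type Joshi's construction, test vs S» (rung LADDER-ABC:A2.E;
TEST-LEDGER rows X-11/X-12). **No side is taken** on [IUTchIII] Cor. 3.12, on Joshi's claims (unrefereed arXiv preprints) or on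
Mochizuki's report on them; typed ≠ proved ≠ endorsed. PROOF-ONLY over abc-iut-E-t43's `Joshi/TestVolumeCharacterDichotomy.lean`
(p431585) and the harness (p428758, p429682): 0 new `def`, no `Prop` fact, no instance, no `sorry`.

## Why this addendum (correction of record, abc-iut-E-t43 2026-08-26 07:53:33Z, conceded by abc-iut-E-cx 08:10:32Z)
`Joshi/TestHullOrVolume.lean` (p431063) states the X-07″ schema under a per-element binder `H1` whose second disjunct asks the powers of
`Φ` ITSELF to escape every hull-set. That disjunct is UNSATISFIABLE for a uniformly contracting `Φ` (`x ↦ p·x` on a ℚ-line), although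
`Φ⁻¹ ∈ ⟨(Ind1) ∪ (Ind2)⟩` destroys the hull — so «`∀ Φ, H1 Φ`» fails at every valuation-rescaling model (abc-iut-E-t41's `scalSetting`
included) and p431063's theorems, while correct, are vacuous exactly there; its docstring sentence «E-t41's `TestIsmDichotomy` discharges
`H1`» is WRONG. The satisfiable per-element form «volume-preserving at the packet ∨ `¬HullDefined` there» is E-t43's
`preserving_or_not_hullDefined_of_volumeCharacter`, derived from VOLUME CHARACTERS of the generators (`logvol (Φ·A) = logvol A + c Φ` on
admissible `A`, two-sided admissibility transport — what Haar measure gives every ℚ_p-linear automorphism and `pVol` gives every scalar on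
the cell's ball frames), and `volumeTransportAt_or_not_hullDefined_of_indCoversQ_of_character` is the packetwise X-07″ conclusion in that
form. THIS FILE draws the two GLOBAL corollaries from it, so that the X-07″ located sentence is kernel-backed with hypotheses that are
DISCHARGED at both inhabited horns (character `0`: the Dupuy–Hilado-level instantiation p430041; character `≠ 0`: `scalSetting`):
* `volumeTransport_of_indCoversQ_of_character`: pins + characters at every packet of `𝔽_l^⋇` + `LogvolMono` + `ThetaRegionsAdm` +
  admissible datum-regions + `HullDefined` everywhere on `𝔽_l^⋇` + `IndCoversQ` ⟹ `VolumeTransport P`;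
* `volumeTransport_and_statement_of_pilotKummerIndRelated_of_character`: **S ∧ `BridgeHyps` ⟹ VT ∧ Statement** (Thm 3.11 (ii)(b) for
  column `n` turns S into `IndCoversQ`; `BridgeHyps.finite` gives `HullDefined`; VT gives the Statement by the S-free route) — wherever the
  S-route `statement_of_pilotKummerCompat (H : BridgeHyps P)` applies, the S-FREE route `statement_of_volumeTransport` already applies;
* `not_statement_of_pilotKummerIndRelated_of_character_thetaBelow`: at ONE packet with honest exponents (every column Θ-datum region
  admissible and strictly smaller in log-volume than the admissible q-datum region) S forces `¬Statement ∧ ¬BridgeHyps` AS TYPED.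
Located properties of OUR typed hull-of-the-full-orbit functional; no judgement on print. [claim: Mochizuki2012, status: disputed]
[claim: Joshi2024ATS3, status: disputed]. Standard axioms only; no `sorry`.
-/

noncomputable section

open Set

namespace Summit.ABC.IUTFork.Joshi

open Thm311 Cor312 Cor312Vol

variable {T : ThetaIndex} {S : LatticeSituation T} {P : Cor312.Setting S.toSituation}
  {ρ : (∀ v : T.V, v ∈ T.Vbad → Set (S.L.StarPacket v)) → ∀ (j : T.Label) (vQ : T.VQ), Set (S.L.Packet j vQ)}
  {qK : ∀ v : T.V, v ∈ T.Vbad → Set (S.L.StarPacket v)}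

/-- **S's containment clause + defined hulls ⟹ volume transport**, under volume characters for the generators at every packet of
`𝔽_l^⋇` (E-t43's packetwise `volumeTransportAt_or_not_hullDefined_of_indCoversQ_of_character`, globalised). [folklore] -/
theorem volumeTransport_of_indCoversQ_of_character (hpin : PinnedRegions S P ρ qK)
    (c : Fin T.lstar → T.VQ → S.L.PacketAut → ℝ)
    (hAdm : ∀ (i : Fin T.lstar) (vQ : T.VQ), ∀ Φ ∈ S.L.Ind1Family ∪ S.L.Ind2Family,
      ∀ A : Set (S.L.Packet (Setting.labelSucc i) vQ),
        (S.D P.n).Adm (Setting.labelSucc i) vQ A ↔ (S.D P.n).Adm (Setting.labelSucc i) vQ (Φ (Setting.labelSucc i) vQ '' A))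
    (hvol : ∀ (i : Fin T.lstar) (vQ : T.VQ), ∀ Φ ∈ S.L.Ind1Family ∪ S.L.Ind2Family,
      ∀ A : Set (S.L.Packet (Setting.labelSucc i) vQ), (S.D P.n).Adm (Setting.labelSucc i) vQ A →
        (S.D P.n).logvol (Setting.labelSucc i) vQ (Φ (Setting.labelSucc i) vQ '' A) =
          (S.D P.n).logvol (Setting.labelSucc i) vQ A + c i vQ Φ)
    (hmono : LogvolMono P) (hΘadm : ThetaRegionsAdm P)
    (hq : ∀ (i : Fin T.lstar) (vQ : T.VQ), (S.D P.n).Adm (Setting.labelSucc i) vQ (ρ qK (Setting.labelSucc i) vQ))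
    (hΘ : ∀ (m : ℤ) (i : Fin T.lstar) (vQ : T.VQ),
      (S.D P.n).Adm (Setting.labelSucc i) vQ (ρ ((S.col P.n).frobΨ m) (Setting.labelSucc i) vQ))
    (hdef : ∀ (i : Fin T.lstar) (vQ : T.VQ), P.HullDefined (Setting.labelSucc i) vQ) (h : IndCoversQ S P ρ qK) :
    VolumeTransport P := fun i vQ =>
  (volumeTransportAt_or_not_hullDefined_of_indCoversQ_of_character P ρ qK hpin (c i vQ) (hAdm i vQ) (hvol i vQ) hmono hΘadm
    (hq i vQ) (fun m => hΘ m i vQ) h).resolve_right (not_not.2 (hdef i vQ))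

/-- **S ∧ BridgeHyps ⟹ VT ∧ Statement** under volume characters (non-vacuous form of the X-07″ headline): Thm. 3.11 (ii)(b) for
column `n` turns S into `IndCoversQ` (`indCoversQ_of_pilotKummerIndRelated`, p428758), `BridgeHyps.finite` supplies `HullDefined` on
`𝔽_l^⋇`, and volume transport gives the Statement by the S-FREE route (`statement_of_subsetVolumeBound ∘ subsetVolumeBound_of_volumeTransport`).
So wherever the S-route `statement_of_pilotKummerCompat (H : BridgeHyps P)` applies, the S-free volume route already applies.
[claim: Mochizuki2012, status: disputed] -/
theorem volumeTransport_and_statement_of_pilotKummerIndRelated_of_character (H : BridgeHyps P)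
    (hKumB : (S.col P.n).KummerB (S.D P.n)) (hpin : PinnedRegions S P ρ qK)
    (c : Fin T.lstar → T.VQ → S.L.PacketAut → ℝ)
    (hAdm : ∀ (i : Fin T.lstar) (vQ : T.VQ), ∀ Φ ∈ S.L.Ind1Family ∪ S.L.Ind2Family,
      ∀ A : Set (S.L.Packet (Setting.labelSucc i) vQ),
        (S.D P.n).Adm (Setting.labelSucc i) vQ A ↔ (S.D P.n).Adm (Setting.labelSucc i) vQ (Φ (Setting.labelSucc i) vQ '' A))
    (hvol : ∀ (i : Fin T.lstar) (vQ : T.VQ), ∀ Φ ∈ S.L.Ind1Family ∪ S.L.Ind2Family,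
      ∀ A : Set (S.L.Packet (Setting.labelSucc i) vQ), (S.D P.n).Adm (Setting.labelSucc i) vQ A →
        (S.D P.n).logvol (Setting.labelSucc i) vQ (Φ (Setting.labelSucc i) vQ '' A) =
          (S.D P.n).logvol (Setting.labelSucc i) vQ A + c i vQ Φ)
    (hmono : LogvolMono P) (hΘadm : ThetaRegionsAdm P)
    (hq : ∀ (i : Fin T.lstar) (vQ : T.VQ), (S.D P.n).Adm (Setting.labelSucc i) vQ (ρ qK (Setting.labelSucc i) vQ))
    (hΘ : ∀ (m : ℤ) (i : Fin T.lstar) (vQ : T.VQ),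
      (S.D P.n).Adm (Setting.labelSucc i) vQ (ρ ((S.col P.n).frobΨ m) (Setting.labelSucc i) vQ))
    (hS : PilotKummerIndRelated S P ρ qK) : VolumeTransport P ∧ P.Statement :=
  have hVT : VolumeTransport P :=
    volumeTransport_of_indCoversQ_of_character hpin c hAdm hvol hmono hΘadm hq hΘ (fun i vQ => hullDefined_of_finite H i vQ)
      (indCoversQ_of_pilotKummerIndRelated hKumB hpin.1.1 hS)
  ⟨hVT, statement_of_subsetVolumeBound H (subsetVolumeBound_of_volumeTransport hΘadm hVT)⟩

/-- **Θ below q at ONE honest packet + S ⟹ the Statement and the bridge hypotheses FAIL AS TYPED** (non-vacuous form): E-t43's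
dichotomy at the honest packet `not_indCoversQ_or_not_statement` with its first horn excluded by S (Thm. 3.11 (ii)(b) + (hρ) turn S into
`IndCoversQ`). The TRICHOTOMY's synthesis: at an honest-volume packet with Θ below q, S can hold only where `^{n,∘}𝒰` is undefined
(inhabited: abc-iut-E-t41's `IsmScaling.scalSetting`, character of `dilateFamily` ≠ 0). [claim: Mochizuki2012, status: disputed] -/
theorem not_statement_of_pilotKummerIndRelated_of_character_thetaBelow (hKumB : (S.col P.n).KummerB (S.D P.n))
    (hpin : PinnedRegions S P ρ qK) {i : Fin T.lstar} {vQ : T.VQ} (c : S.L.PacketAut → ℝ)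
    (hAdm : ∀ Φ ∈ S.L.Ind1Family ∪ S.L.Ind2Family, ∀ A : Set (S.L.Packet (Setting.labelSucc i) vQ),
      (S.D P.n).Adm (Setting.labelSucc i) vQ A ↔ (S.D P.n).Adm (Setting.labelSucc i) vQ (Φ (Setting.labelSucc i) vQ '' A))
    (hvol : ∀ Φ ∈ S.L.Ind1Family ∪ S.L.Ind2Family, ∀ A : Set (S.L.Packet (Setting.labelSucc i) vQ),
      (S.D P.n).Adm (Setting.labelSucc i) vQ A →
        (S.D P.n).logvol (Setting.labelSucc i) vQ (Φ (Setting.labelSucc i) vQ '' A) =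
          (S.D P.n).logvol (Setting.labelSucc i) vQ A + c Φ)
    (hmono : LogvolMono P) (m₀ : ℤ)
    (hΘm : (S.D P.n).Adm (Setting.labelSucc i) vQ (P.thetaRegion m₀ (Setting.labelSucc i) vQ))
    (hq : (S.D P.n).Adm (Setting.labelSucc i) vQ (ρ qK (Setting.labelSucc i) vQ))
    (hΘ : ∀ m : ℤ, (S.D P.n).Adm (Setting.labelSucc i) vQ (ρ ((S.col P.n).frobΨ m) (Setting.labelSucc i) vQ))
    (hlt : ∀ m : ℤ, (S.D P.n).logvol (Setting.labelSucc i) vQ (ρ ((S.col P.n).frobΨ m) (Setting.labelSucc i) vQ) <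
      (S.D P.n).logvol (Setting.labelSucc i) vQ (ρ qK (Setting.labelSucc i) vQ))
    (hS : PilotKummerIndRelated S P ρ qK) : ¬ P.Statement ∧ ¬ BridgeHyps P :=
  (not_indCoversQ_or_not_statement P ρ qK c hAdm hvol hmono m₀ hΘm hq hΘ hlt).resolve_left
    (not_not.2 (indCoversQ_of_pilotKummerIndRelated hKumB hpin.1.1 hS))

end Summit.ABC.IUTFork.Joshi

end
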